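import Summits.QuantumFields.YangMills.Theorems.UnitScaleTiltProp7CombTildPureGauge
import Summits.QuantumFields.YangMills.Theorems.UnitScaleTiltProp7CornerCombStructure
import HarnessLib

/-!
# Route `UnitScaleTilt`, crux K1 «MinimiserStabilityRegPr» (stmt-QuantumFields-19200), route-R E′ (A′)-on-Σ, P-A2 (β), rows «(n3)-comb» ∕ (R-LEGS-cov) —
# «THE LINEARISED CORNERED TOWER IS EXACT ON PURE GAUGES, EVERY LEVEL»: **`Q l (∇^{U₀}φ) (z, κ) = φ(Lˡ•z) − Ad_{Ū₀ˡ(z,κ)} φ(Lˡ•z + Lˡ•e_κ)`** for EVERY family `Q` with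
# ★routeR-w1 g9's ✓`Prop7CornerCombStructure.exists_linTower_family` texts — F-3's one-step exactness ✓`Prop7CombTildPureGauge.trueLin_covGrad_eq_level` ITERATED.

Cell `ym3-torus` (HUMAN RULING D-0037: YM₃ on the torus is ladder rung R3 — not d = 4, not a mass gap, not Clay), twin-width seat `ym-routeR-w2` (gen 10); typed AT OWN RISK after the
(K2)-row episode of 09:33–09:45Z (w4-20520 g12's displayed mass row (hN) `Σ_{cell l}‖Q l (A♯)‖² ≤ CN·(Lˡ)⁻¹·Σ‖A‖²` is contradicted by this identity at `A := ∇(δ_{x₀}·σ)`, flat member: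
the left side is `2d‖σ‖²` at every level); «(O2) groundwork» (★★OWNER RULINGS №20 (2), №22 (c)); `--supports stmt-QuantumFields-19200 --as helper`; THEOREMS ONLY (0 `def`, 0 `sorry`);
count-neutral.  Nothing of `hMcomb`, `hMcomb₂`, (R-LEGS-cov), (β), `hPA2`, `hcoS`, E′, EX, the crux, d = 4 or the gap is claimed.

THE POINT.  MASTER memo `DESIGN-N3COMB-LINEAR-CORE-routeRw1g9.md` §6 (R2) asks the linear core to be «exactly `Lᵏ` on harmonic forms ∕ blind to pure gauges in the A-slot»; §4
names the «gauge bump at a level-l corner» as the test family of every `ℓ¹`∕`ℓ²` row of the tower.  The kernel certificate of both is the iterate of F-3: by induction on `l` over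
the recursion text `Q (l+1) Y (z,κ) = T_l(Q l Y)(L•z, κ)` and ✓`trueLin_covGrad_eq_level` at the potential `φ ∘ (Lˡ•·)`, with `Lˡ•(L•z) = Lˡ⁺¹•z` and lit ✓`avgIter_zero` at `l = 0`.
Consequence for row design (numbers, not taste): a per-level MASS row for `Y_l := Q l (A♯)` can decay like `(Lˡ)⁻¹` only in the A-slot `M₀(A)` and MUST carry a gradient∕`KD` slot
(MASTER §2: `c_A·M₀·(Lˡ)⁻¹ + c_B(L)·KD·Lˡ`), since for `A = ∇^{U₀}φ` the level-`l` field is the coarse gradient of the SAME potential sampled at the corners — no contraction at all.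

WHAT IS PROVED (ns `…Theorems.Prop7CornerCombLinTowerPureGauge`; `𝔸` any C⋆-algebra; every `d`, `L`, `U₀`, `φ`).
* ★★★ `linTower_covGrad_eq` — the title, `∀ l ≤ n` under the loop window `‖W(Ū₀ᵏ)(L•z,κ,r) − 1‖ < 1` for `k < n` (H-1's `hW` shape).
* `linTower_covGrad_eq_zero_iff`-free corollary ★ `linTower_covGrad_flat` — the flat background `U₀ = 1`: `Q l (∇φ)(z,κ) = φ(Lˡ•z) − φ(Lˡ•z + Lˡ•e_κ)` (every `Ad = id`; window automatic:
  `W(1) = 1`).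
HONEST SCOPE.  Identities; no estimate.  Rung R3, not Clay; YM gap NOT proved.

References: T. Bałaban, CMP **98** (1985) 17–51 [Balaban1985Averaging] ((11) p.19, (43) p.24, (65)∕(68)∕(69) p.29, (119)–(120) p.35); CMP **95** (1984) 17–40 [Balaban1984PropagatorsI]
((1.20) p.20); CMP **109** (1987) 249–301 [Balaban1987RG1] ((0.4), (0.6) p.253).
-/

set_option autoImplicit false

noncomputable section

open scoped BigOperators

namespace Summit.QuantumFields.YangMills.Theorems.Prop7CornerCombLinTowerPureGauge

open NormedSpace
open Literature.MathematicalPhysics.QuantumFieldTheory.Balaban1983to89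
open ExpMeanLog (eml)
open B7Prop1Explicit (Site e seg boxVec gammaWord Wcx Xavg expUnit)
open B7Prop2Explicit (avgIter avgIter_zero)
open B7Eq78Linearization (conjR)
open B7Prop3GeneralRotated (tsum)
open Summit.QuantumFields.YangMills.Theorems.Prop7CombTildPureGauge (trueLin_covGrad_eq_level)

variable {d : ℕ} {𝔸 : Type*} [CStarAlgebra 𝔸]

/-- ★★★ **THE LINEARISED CORNERED TOWER IS EXACT ON PURE GAUGES, EVERY LEVEL.**  `Q` any family with ✓`exists_linTower_family`'s texts (`Q 0 Y = Y`, `Q (k+1) Y (z,κ) = T_k(Q k Y)(L•z,κ)`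
with `T_k` the cornered one-step true derivative at `Ū₀ᵏ` written out); `Y := ∇^{U₀}φ` (`Y x μ = φ x − Ad_{U₀(x,μ)}φ(x + e_μ)`); block loops of `Ū₀ᵏ` at the corners in the unit window
for `k < n`.  THEN for every `l ≤ n` and every bond `(z, κ)`: `Q l Y z κ = φ(Lˡ•z) − Ad_{Ū₀ˡ(z,κ)}φ(Lˡ•z + Lˡ•e_κ)`. [cite: Balaban1985Averaging, (11) p.19, (43) p.24, (68)-(69) p.29, (119)-(120) p.35; Balaban1984PropagatorsI, (1.20) p.20] -/
theorem linTower_covGrad_eq (L : ℕ) (U₀ : Site d → Fin d → 𝔸ˣ) (φ : Site d → 𝔸) (Y : Site d → Fin d → 𝔸)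
    (hY : ∀ x μ, Y x μ = φ x - conjR (U₀ x μ) (φ (x + e μ)))
    (Q : ℕ → (Site d → Fin d → 𝔸) → Site d → Fin d → 𝔸) (hQ0 : ∀ Y, Q 0 Y = Y)
    (hQs : ∀ (k : ℕ) (Y : Site d → Fin d → 𝔸) (z : Site d) (κ : Fin d), Q (k + 1) Y z κ
        = fderiv ℂ (eml : ((Fin d → Fin L) → 𝔸) → 𝔸) (fun r => ((Wcx L (avgIter L U₀ k) ((L : ℤ) • z) κ (boxVec L r) : 𝔸ˣ) : 𝔸))
              (fun r => tsum (avgIter L U₀ k) (Q k Y) ((L : ℤ) • z) (gammaWord L κ (boxVec L r) ++ seg κ (-(L : ℤ)))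
                * ((Wcx L (avgIter L U₀ k) ((L : ℤ) • z) κ (boxVec L r) : 𝔸ˣ) : 𝔸))
              * (((expUnit (Xavg L (avgIter L U₀ k) ((L : ℤ) • z) κ))⁻¹ : 𝔸ˣ) : 𝔸)
            + ((expUnit (Xavg L (avgIter L U₀ k) ((L : ℤ) • z) κ) : 𝔸ˣ) : 𝔸) * tsum (avgIter L U₀ k) (Q k Y) ((L : ℤ) • z) (seg κ (L : ℤ))
              * (((expUnit (Xavg L (avgIter L U₀ k) ((L : ℤ) • z) κ))⁻¹ : 𝔸ˣ) : 𝔸))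
    {n : ℕ} (hW : ∀ k : ℕ, k < n → ∀ (z : Site d) (κ : Fin d) (r : Fin d → Fin L),
      ‖((Wcx L (avgIter L U₀ k) ((L : ℤ) • z) κ (boxVec L r) : 𝔸ˣ) : 𝔸) - 1‖ < 1) :
    ∀ l : ℕ, l ≤ n → ∀ (z : Site d) (κ : Fin d),
      Q l Y z κ = φ (((L : ℤ) ^ l) • z) - conjR (avgIter L U₀ l z κ) (φ (((L : ℤ) ^ l) • z + ((L : ℤ) ^ l) • e κ)) := by
  intro l
  induction l with
  | zero =>
    intro _ z κ
    rw [hQ0, hY, avgIter_zero, pow_zero, one_smul, one_smul]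
  | succ l ih =>
    intro hl z κ
    have hl' : l ≤ n := Nat.le_of_succ_le hl
    -- the level-`l` field is the covariant gradient of `φ ∘ (Lˡ•·)` at the background `Ū₀ˡ`
    have hYl : ∀ x μ, Q l Y x μ = (fun y => φ (((L : ℤ) ^ l) • y)) x - conjR (avgIter L U₀ l x μ) ((fun y => φ (((L : ℤ) ^ l) • y)) (x + e μ)) := by
      intro x μ
      simp only [smul_add]
      exact ih hl' x μ
    rw [hQs l Y z κ, trueLin_covGrad_eq_level L U₀ l (fun y => φ (((L : ℤ) ^ l) • y)) (Q l Y) hYl z κ (hW l (Nat.lt_of_succ_le hl) z κ)]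
    simp only [smul_add, smul_smul, pow_succ]

/-- ★ **FLAT BACKGROUND**: at `U₀ = 1` every transport is the identity and every block loop is `1`, so for every family `Q` with the texts at `U₀ = 1` and every `l`:
`Q l (∇φ)(z, κ) = φ(Lˡ•z) − φ(Lˡ•z + Lˡ•e_κ)` — the coarse gradient of the SAME potential at the level-`l` corners (no contraction: the «gauge bump» test family of MASTER §4).
[cite: Balaban1985Averaging, (11) p.19, (119)-(120) p.35; Balaban1984PropagatorsI, (1.20) p.20] -/
theorem linTower_covGrad_flat (L : ℕ) (φ : Site d → 𝔸)
    (Q : ℕ → (Site d → Fin d → 𝔸) → Site d → Fin d → 𝔸) (hQ0 : ∀ Y, Q 0 Y = Y)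
    (hQs : ∀ (k : ℕ) (Y : Site d → Fin d → 𝔸) (z : Site d) (κ : Fin d), Q (k + 1) Y z κ
        = fderiv ℂ (eml : ((Fin d → Fin L) → 𝔸) → 𝔸) (fun r => ((Wcx L (avgIter L (1 : Site d → Fin d → 𝔸ˣ) k) ((L : ℤ) • z) κ (boxVec L r) : 𝔸ˣ) : 𝔸))
              (fun r => tsum (avgIter L (1 : Site d → Fin d → 𝔸ˣ) k) (Q k Y) ((L : ℤ) • z) (gammaWord L κ (boxVec L r) ++ seg κ (-(L : ℤ)))
                * ((Wcx L (avgIter L (1 : Site d → Fin d → 𝔸ˣ) k) ((L : ℤ) • z) κ (boxVec L r) : 𝔸ˣ) : 𝔸))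
              * (((expUnit (Xavg L (avgIter L (1 : Site d → Fin d → 𝔸ˣ) k) ((L : ℤ) • z) κ))⁻¹ : 𝔸ˣ) : 𝔸)
            + ((expUnit (Xavg L (avgIter L (1 : Site d → Fin d → 𝔸ˣ) k) ((L : ℤ) • z) κ) : 𝔸ˣ) : 𝔸)
                * tsum (avgIter L (1 : Site d → Fin d → 𝔸ˣ) k) (Q k Y) ((L : ℤ) • z) (seg κ (L : ℤ))
              * (((expUnit (Xavg L (avgIter L (1 : Site d → Fin d → 𝔸ˣ) k) ((L : ℤ) • z) κ))⁻¹ : 𝔸ˣ) : 𝔸))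
    (l : ℕ) (z : Site d) (κ : Fin d) :
    Q l (fun x μ => φ x - φ (x + e μ)) z κ = φ (((L : ℤ) ^ l) • z) - φ (((L : ℤ) ^ l) • z + ((L : ℤ) ^ l) • e κ) := by
  have havg : ∀ k : ℕ, avgIter L (1 : Site d → Fin d → 𝔸ˣ) k = 1 := fun k => B7Eq92Concrete.avgIter_one L k
  have hW : ∀ k : ℕ, k < l → ∀ (z : Site d) (κ : Fin d) (r : Fin d → Fin L),
      ‖((Wcx L (avgIter L (1 : Site d → Fin d → 𝔸ˣ) k) ((L : ℤ) • z) κ (boxVec L r) : 𝔸ˣ) : 𝔸) - 1‖ < 1 := by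
    intro k _ z κ r
    rw [havg, B8Ineq130.Wcx_one, Units.val_one, sub_self, norm_zero]
    exact one_pos
  have h := linTower_covGrad_eq L (1 : Site d → Fin d → 𝔸ˣ) φ (fun x μ => φ x - φ (x + e μ))
    (fun x μ => by rw [Pi.one_apply, Pi.one_apply, B8Eq191FlatStencils.conjR_unitOne]) Q hQ0 hQs hW l le_rfl z κ
  rw [h, havg, Pi.one_apply, Pi.one_apply, B8Eq191FlatStencils.conjR_unitOne]

end Summit.QuantumFields.YangMills.Theorems.Prop7CornerCombLinTowerPureGauge

end
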